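import Summits.CriticalPhenomena.PercolationContinuityZ3.Theorems.PercNearOneGluingNoHeavyQuantGatedSliceMixLawC1
import HarnessLib

/-!
# QUANT lane R8, T-DEC, leg (III), blob case — `LawDec.GatedSliceMixLaw'`, REGIME C2 PROVED: the shifted low `k₁ + a` a `t`-low,
# `k₂` a MID of the moved law (`k₂ ≤ j`) SATURATED by the shifted low, `k₂ + a` a giant, both atoms of the weak-mid law at most `j` —
# the exchange certificate with the moved law's own mid filled first; the single inequality again collapses to `y·k₂ ≤ S`

builds on p205010 (kernel theorem, internal audit signed; external expert review pending)

Support file (`--supports stmt-CriticalPhenomena-4575`), QUANT lane typer seat prim-quant-stmt (gen 30), rung R8 of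
`run/shared/lean/prim/quant/LADDER.md`.  Memo `run/shared/lean/prim/quant/prim-quant-stmt-g30/MIXLAW-MIXTURES-G30.md` §5.  Theorems only,
standard axioms, no sorries.  Tools: `…QuantGatedSliceMixLawExchange`, `…QuantGatedSliceMixLawC1` (`flowAtT_weakMidShare`, `weakMid_capacity_ge`).

THE REGIME (signatures LLMGMM / LLMGmM / LLmGmM of the seat's census — 55 % of all genuine instances of `GatedSliceMixLaw'`).  Frame of
`GatedSliceMixLaw'`; `2(k₁+a) < t`, `k₁ + a ≤ j`; `k₂ ≤ j`, `2k₂ ≥ t`, `t < k₁ + a + k₂` (the top `k₂` is a mid compatible with the shifted low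
`ℓ = k₁ + a`); `k₂ + a ≥ j+1`; `h + a ≤ j`, `2h ≥ t`; and the SATURATION hypothesis `m₂ ≤ m₁'·usage(ℓ, k₂)` (`m₂ = (1−z)λ(1−g)`,
`m₁' = (1−z)(1−λ)g`): the mid `k₂` cannot absorb the whole shifted low.  (When it can, the moved law is DEC by itself — exact census of the seat,
7 000 / 0 — a `θ = 0` cell of the Q-alone side, arm-1's seam; not treated here.)  `W_h ∉ D` is again not needed.

THE CERTIFICATE (plan Π of the memo).  (1) the mid `k₂` of `P` absorbs `α = m₂/usage(ℓ,k₂)` of the shifted low (exactly filling it);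
(2) the rest `ℓ' = m₁' − α` of the shifted low and the whole low `k₁` ride the two mids of `W` (shares `c_ℓ = (1−θ)ℓ'/K_ℓ`, `c₁ = (1−θ)m₁/K₁`,
`c₁ + c_ℓ = θ`); (3) every zero rides the giant `k₂ + a` of `P`; `θ/(1−θ) = ρ = m₁/K₁ + ℓ'/K_ℓ` (balance point).  The zeros fit iff
`y(z + ρ w₀) ≤ (1−y)(1−z)λg`.  THE INEQUALITY: as in regime C1, `ρ w₀ ≤ [m₁(t−k₁) + ℓ'(t−ℓ)]/S`; the new ingredient is
**`usage(ℓ,k₂)·(k₂ − S) ≤ t − ℓ`** (`usage_mul_sub_le`: heavy pairs by `t − S = ag(1−z) ≤ ℓ`, light pairs by `γ ≤ y`, `y k₂ ≤ S` and a slack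
`ℓ(1−y)²`), which turns the saved income `α(t − ℓ)` into `≥ m₂(k₂ − S)`; then the zero inequality reads `y[λg(k₂−S) − (1−λ)agz] ≤ (1−y)λgS ⟸ y·k₂ ≤ S`.
Exact census of the seat: 0 failures on ≈ 55 000 regime instances (M ≤ 120), genuine or not.

* `LawDec.usage_mul_sub_le` — `usage(ℓ,m)·(m − S) ≤ t − ℓ` for a low `ℓ ≥ t − S` and a compatible mid `m` with `y·m ≤ S ≤ t`.
* **`LawDec.gatedSliceMixLaw_regimeC2`** — the conclusion of `GatedSliceMixLaw'` in regime C2.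

[this work]; exchange architecture: this seat (gen 30); flow form / criterion E / usage bounds: prim-quant-stmt g22–g27, arm-1 g39 (this lane).
Nothing here is cited as a published result.  The gluing rows served [cite: KozmaNitzan2024, Conjecture 3 (p. 15)]; product measure
[cite: Grimmett1999, §1.3 p. 10].
-/

noncomputable section

namespace Summit.CriticalPhenomena.PercolationContinuityZ3.Theorems

namespace Quant

open Finset

/-- the two-point law `{lo, hi; g}` (as in `…QuantLawDEC`) -/
local notation3 "TP[" lo ", " hi ", " g ", " h "]" =>
  (g : ℝ) * (if (h : ℕ) = (hi : ℕ) then (1 : ℝ) else 0) + (1 - (g : ℝ)) * (if (h : ℕ) = (lo : ℕ) then (1 : ℝ) else 0)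

namespace LawDec

/-! ### The saturated-mid slack -/

/-- **`usage(ℓ,m)·(m − S) ≤ t − ℓ`** for `0 < y < 1`, a low `ℓ` (`2ℓ < t`) with `t − S ≤ ℓ`, a mid `m ≤ j` compatible with it (`t < ℓ + m`),
`y·m ≤ S ≤ t`.  Heavy pairs (`γ = ρ = (t−2ℓ)/(m−ℓ)`): `ρ(m − S + t − ℓ) = (t − 2ℓ) + ρ(t − S) ≤ t − ℓ`.  Light pairs (`γ = y² + (1−y)ρ ≤ y`):
the slack is at least `ℓ(1−y)²`. [this work] -/
theorem usage_mul_sub_le (y t S : ℝ) (j l m : ℕ) (hy0 : 0 < y) (hy1 : y < 1) (hlow : 2 * (l : ℝ) < t) (hmj : m ≤ j)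
    (hcomp : t < (l : ℝ) + m) (hym : y * (m : ℝ) ≤ S) (hSt : S ≤ t) (htSl : t - S ≤ (l : ℝ)) :
    usage y t j l m * ((m : ℝ) - S) ≤ t - l := by
  have hnj : ¬ (j + 1 ≤ m) := by omega
  simp only [usage, gateOf, if_neg hnj]
  have hl0 : (0 : ℝ) ≤ l := Nat.cast_nonneg l
  have hD : (0 : ℝ) < (m : ℝ) - l := by linarith
  set ρ : ℝ := (t - 2 * (l : ℝ)) / ((m : ℝ) - l) with hρ
  have hρD : ρ * ((m : ℝ) - l) = t - 2 * (l : ℝ) := by rw [hρ]; field_simp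
  have hρ0 : 0 < ρ := div_pos (by linarith) hD
  have hρ1 : ρ < 1 := by rw [hρ, div_lt_one hD]; linarith
  have hγlt : pairGate y t l m < 1 := pairGate_lt_one y t l m hy0 hy1 hlow hcomp
  set γ := pairGate y t l m with hγ
  have h1γ : 0 < 1 - γ := by linarith
  rw [div_mul_eq_mul_div, div_le_iff₀ h1γ]
  -- need γ (m − S) ≤ (t − l)(1 − γ)
  by_cases hcase : y ≤ ρ
  · -- heavy: γ = ρ, and ρ (t − S) ≤ t − S ≤ l
    have hγρ : γ = ρ := by
      rw [hγ]; unfold pairGate; rw [← hρ]; exact max_eq_left (by nlinarith)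
    rw [hγρ]
    have key : ρ * (t - S) ≤ (l : ℝ) := le_trans (mul_le_mul_of_nonneg_right hρ1.le (by linarith)) (by linarith)
    have e : ρ * ((m : ℝ) - S) = (t - 2 * (l : ℝ)) + ρ * ((l : ℝ) - S) := by rw [← hρD]; ring
    have e2 : (t - (l : ℝ)) * (1 - ρ) = (t - 2 * (l : ℝ)) + ρ * ((l : ℝ) - S) + ((l : ℝ) - ρ * (t - S)) := by ring
    rw [e, e2]; linarith
  · -- light: γ = y² + (1−y)ρ ≤ y; slack ≥ l (1 − y)²
    have hρy : ρ < y := lt_of_not_ge hcase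
    have hγe : γ = y ^ 2 + (1 - y) * ρ := by
      rw [hγ]; unfold pairGate; rw [← hρ]; exact max_eq_right (by nlinarith)
    rw [hγe]
    have hγ'y : y ^ 2 + (1 - y) * ρ ≤ y := by nlinarith
    have b1 : y ^ 2 * ((m : ℝ) - l) ≤ y * S - y ^ 2 * l := by nlinarith
    have b2 : (y ^ 2 + (1 - y) * ρ) * (t - S) ≤ y * (t - S) := mul_le_mul_of_nonneg_right hγ'y (by linarith)
    have b3 : 0 ≤ (l : ℝ) * (1 - y) ^ 2 := mul_nonneg hl0 (sq_nonneg _)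
    have e : (y ^ 2 + (1 - y) * ρ) * ((m : ℝ) - S)
        = y ^ 2 * ((m : ℝ) - l) + (1 - y) * (ρ * ((m : ℝ) - l)) + (y ^ 2 + (1 - y) * ρ) * ((l : ℝ) - S) := by ring
    have e2 : (t - (l : ℝ)) * (1 - (y ^ 2 + (1 - y) * ρ))
        = (t - (l : ℝ)) - (y ^ 2 + (1 - y) * ρ) * (t - S) - (y ^ 2 + (1 - y) * ρ) * (S - (l : ℝ)) := by ring
    have e3 : (l : ℝ) * (1 - y) ^ 2 = l - 2 * y * l + y ^ 2 * l := by ring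
    rw [e, e2, hρD]
    nlinarith [b1, b2, b3, e3]

/-! ### Regime C2 -/

set_option maxHeartbeats 800000 in
/-- **`GatedSliceMixLaw'` IN REGIME C2** (`2(k₁+a) < t`, `k₁+a ≤ j`; `k₂ ≤ j`, `2k₂ ≥ t`, `t < k₁+a+k₂`; `k₂+a ≥ j+1`; `h+a ≤ j`, `2h ≥ t`;
saturation `(1−z)λ(1−g) ≤ (1−z)(1−λ)g·usage(k₁+a, k₂)`): the conclusion of `GatedSliceMixLaw'` (`W_h ∉ D` not needed).  See the file header. [this work] -/
theorem gatedSliceMixLaw_regimeC2 (y z g S lam : ℝ) (a j M h k₁ k₂ : ℕ)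
    (hy0 : 0 < y) (hy1 : y < 1) (hz0 : 0 ≤ z) (hz1 : z < 1) (hg1 : g ≤ 1) (hyg : y ≤ (1 - z) * g) (hjM : j < M + a)
    (hS0 : 0 < S) (hta : y * (M : ℝ) ≤ S) (hhM : h ≤ M) (hSh : S < (h : ℝ))
    (hk : k₁ ≤ k₂) (hk₂M : k₂ ≤ M) (hlam0 : 0 ≤ lam) (hlam1 : lam ≤ 1)
    (hmean : (1 - z) * ((k₁ : ℝ) + ((k₂ : ℝ) - k₁) * lam) = S)
    (hllow : 2 * ((k₁ + a : ℕ) : ℝ) < S + (a : ℝ) * g * (1 - z)) (hlj : k₁ + a ≤ j)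
    (hk₂j : k₂ ≤ j) (hk₂mid : S + (a : ℝ) * g * (1 - z) ≤ 2 * (k₂ : ℝ)) (hcomp₂ : S + (a : ℝ) * g * (1 - z) < ((k₁ + a : ℕ) : ℝ) + k₂)
    (hk₂aG : j + 1 ≤ k₂ + a) (hhaj : h + a ≤ j) (hhmid : S + (a : ℝ) * g * (1 - z) ≤ 2 * (h : ℝ))
    (hsat : (1 - z) * lam * (1 - g) ≤ (1 - z) * (1 - lam) * g * usage y (S + (a : ℝ) * g * (1 - z)) j (k₁ + a) k₂) :
    ∃ θ : ℝ, 0 ≤ θ ∧ θ < 1 ∧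
      DECAtT y (S + (a : ℝ) * g * (1 - z)) j (M + a)
        (fun p => θ * weakMidLaw S g h a p
          + (1 - θ) * (z * (if p = 0 then (1 : ℝ) else 0) + (1 - z) * slice (fun q => TP[k₁, k₂, lam, q]) a g p)) := by
  classical
  set t : ℝ := S + (a : ℝ) * g * (1 - z) with ht
  -- basic positivity
  have h1z : 0 < 1 - z := by linarith
  have hg0 : 0 < g := by nlinarith
  have h1y : 0 < 1 - y := by linarith
  have ha0 : (0 : ℝ) ≤ a := Nat.cast_nonneg a
  have hh0 : (0 : ℝ) < h := lt_trans hS0 hSh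
  have hk₁0 : (0 : ℝ) ≤ k₁ := Nat.cast_nonneg k₁
  have hSh' : 0 < S / (h : ℝ) := div_pos hS0 hh0
  have hw0 : 0 ≤ 1 - S / (h : ℝ) := by rw [sub_nonneg, div_le_one hh0]; exact hSh.le
  have h1lam : 0 ≤ 1 - lam := by linarith
  have hagz : 0 ≤ (a : ℝ) * g * z := mul_nonneg (mul_nonneg ha0 hg0.le) hz0
  have hk1low : 2 * (k₁ : ℝ) < t := by push_cast at hllow; linarith
  have hyk₂ : y * (k₂ : ℝ) ≤ S := le_trans (mul_le_mul_of_nonneg_left (by exact_mod_cast hk₂M) hy0.le) hta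
  have hSt : S ≤ t := by rw [ht]; nlinarith [mul_nonneg ha0 hg0.le]
  have htSl : t - S ≤ ((k₁ + a : ℕ) : ℝ) := by
    push_cast; rw [ht]; nlinarith [mul_nonneg ha0 hg0.le, mul_nonneg (mul_nonneg ha0 hg0.le) hz0]
  have htaha : y * ((h + a : ℕ) : ℝ) ≤ t := by
    have : ((h + a : ℕ) : ℝ) ≤ ((M + a : ℕ) : ℝ) := by exact_mod_cast (by omega : h + a ≤ M + a)
    push_cast at this ⊢; rw [ht]; nlinarith [mul_nonneg ha0 hg0.le]
  -- masses
  set m₁ : ℝ := (1 - z) * (1 - lam) * (1 - g) with hm₁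
  set m₁' : ℝ := (1 - z) * (1 - lam) * g with hm₁'
  set m₂ : ℝ := (1 - z) * lam * (1 - g) with hm₂
  set m₂' : ℝ := (1 - z) * lam * g with hm₂'
  have hm₁0 : 0 ≤ m₁ := mul_nonneg (mul_nonneg h1z.le h1lam) (by linarith)
  have hm₁'0 : 0 ≤ m₁' := mul_nonneg (mul_nonneg h1z.le h1lam) hg0.le
  have hm₂0 : 0 ≤ m₂ := mul_nonneg (mul_nonneg h1z.le hlam0) (by linarith)
  have hm₂'0 : 0 ≤ m₂' := mul_nonneg (mul_nonneg h1z.le hlam0) hg0.le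
  -- the saturated mid k₂ of P
  set Ul : ℝ := usage y t j (k₁ + a) k₂ with hUl
  have hlk₂ : k₁ + a < k₂ := by
    have : ((k₁ + a : ℕ) : ℝ) < k₂ := by push_cast at hllow hcomp₂ ⊢; linarith
    exact_mod_cast this
  have hUlpos : 0 < Ul := usage_pos_of_compat y t j (k₁ + a) k₂ hy0 hy1 hllow hlk₂ (Or.inr hcomp₂)
  set α : ℝ := m₂ / Ul with hα
  have hα0 : 0 ≤ α := div_nonneg hm₂0 hUlpos.le
  have hαU : Ul * α = m₂ := by rw [hα]; field_simp
  set l' : ℝ := m₁' - α with hl'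
  have hl'0 : 0 ≤ l' := by
    rw [hl', hα, sub_nonneg, div_le_iff₀ hUlpos]; exact hsat
  -- capacities of the donors in W's mids
  obtain ⟨K₁, hK₁⟩ : ∃ K : ℝ, K = (if t < (k₁ : ℝ) + h then S / h * (1 - g) / usage y t j k₁ h else 0)
      + S / h * g / usage y t j k₁ (h + a) := ⟨_, rfl⟩
  obtain ⟨Kl, hKl⟩ : ∃ K : ℝ, K = (if t < ((k₁ + a : ℕ) : ℝ) + h then S / h * (1 - g) / usage y t j (k₁ + a) h else 0)
      + S / h * g / usage y t j (k₁ + a) (h + a) := ⟨_, rfl⟩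
  have hK₁ge := weakMid_capacity_ge y t S g z j h a k₁ hy0 hy1 hg0.le hg1 hz0 hS0.le hSh ht hk1low hhaj htaha
  have hKlge := weakMid_capacity_ge y t S g z j h a (k₁ + a) hy0 hy1 hg0.le hg1 hz0 hS0.le hSh ht hllow hhaj htaha
  rw [← hK₁] at hK₁ge
  rw [← hKl] at hKlge
  have htk₁ : 0 < t - k₁ := by linarith
  have htl : 0 < t - ((k₁ + a : ℕ) : ℝ) := by
    have : (0 : ℝ) ≤ ((k₁ + a : ℕ) : ℝ) := Nat.cast_nonneg _
    linarith
  have hc0 : 0 < S / h * ((h : ℝ) - S) := mul_pos hSh' (by linarith)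
  have hK₁pos : 0 < K₁ := lt_of_lt_of_le (div_pos hc0 htk₁) hK₁ge
  have hKlpos : 0 < Kl := lt_of_lt_of_le (div_pos hc0 htl) hKlge
  -- the balance point
  obtain ⟨ρ, hρ⟩ : ∃ r : ℝ, r = m₁ / K₁ + l' / Kl := ⟨_, rfl⟩
  have hρ0 : 0 ≤ ρ := by rw [hρ]; exact add_nonneg (div_nonneg hm₁0 hK₁pos.le) (div_nonneg hl'0 hKlpos.le)
  obtain ⟨θ, hθ⟩ : ∃ q : ℝ, q = ρ / (1 + ρ) := ⟨_, rfl⟩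
  have hθ0 : 0 ≤ θ := by rw [hθ]; exact div_nonneg hρ0 (by linarith)
  have hθ1 : θ < 1 := by rw [hθ, div_lt_one (by linarith)]; linarith
  have h1θ : 0 < 1 - θ := by linarith
  have hθρ : θ = (1 - θ) * ρ := by rw [hθ]; field_simp; ring
  obtain ⟨c₁, hc₁⟩ : ∃ q : ℝ, q = (1 - θ) * m₁ / K₁ := ⟨_, rfl⟩
  obtain ⟨cl, hcl⟩ : ∃ q : ℝ, q = (1 - θ) * l' / Kl := ⟨_, rfl⟩
  have hc₁0 : 0 ≤ c₁ := by rw [hc₁]; exact div_nonneg (mul_nonneg h1θ.le hm₁0) hK₁pos.le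
  have hcl0 : 0 ≤ cl := by rw [hcl]; exact div_nonneg (mul_nonneg h1θ.le hl'0) hKlpos.le
  have hK₁ne : K₁ ≠ 0 := hK₁pos.ne'
  have hKlne : Kl ≠ 0 := hKlpos.ne'
  have hc₁K : c₁ * K₁ = (1 - θ) * m₁ := by rw [hc₁]; field_simp
  have hclK : cl * Kl = (1 - θ) * l' := by rw [hcl]; field_simp
  have hcsum : c₁ + cl = θ := by
    calc c₁ + cl = (1 - θ) * (m₁ / K₁ + l' / Kl) := by rw [hc₁, hcl]; ring
      _ = (1 - θ) * ρ := by rw [hρ]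
      _ = θ := hθρ.symm
  -- the W-side: two shares
  have hhaN : h + a ≤ M + a := by omega
  have hcomp1 : t < (k₁ : ℝ) + ((h + a : ℕ) : ℝ) := by
    push_cast; have : (a : ℝ) * g * (1 - z) ≤ a := by nlinarith [mul_nonneg ha0 hg0.le]
    rw [ht]; linarith
  have hcompl : t < ((k₁ + a : ℕ) : ℝ) + ((h + a : ℕ) : ℝ) := by push_cast at hcomp1 ⊢; linarith
  have hk₁j : k₁ ≤ j := by omega
  have W1 := flowAtT_weakMidShare y t S g c₁ j (M + a) h a k₁ hy0 hy1 hg0.le hg1 hS0.le hc₁0 hk₁j hk1low hhaN hhmid hcomp1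
  have Wl := flowAtT_weakMidShare y t S g cl j (M + a) h a (k₁ + a) hy0 hy1 hg0.le hg1 hS0.le hcl0 hlj hllow hhaN hhmid hcompl
  rw [← hK₁] at W1
  rw [← hKl] at Wl
  -- the P-side, part 1: the saturated pair (ℓ, k₂), scaled by (1 − θ)
  have Pk₂ := flowAtT_pair y t j (M + a) (k₁ + a) k₂ ((1 - θ) * α) ((1 - θ) * m₂) hlj hllow (by omega) (Or.inr hk₂mid)
    (Or.inr hcomp₂) (mul_nonneg h1θ.le hα0) (le_of_eq (by rw [← hαU, ← hUl]; ring))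
  -- THE inequality: the zeros fit the giant k₂ + a
  have hineq : y / (1 - y) * (z + ρ * (1 - S / h)) ≤ m₂' := by
    have hb1 : m₁ / K₁ ≤ m₁ * (t - k₁) / (S / h * ((h : ℝ) - S)) := by
      rw [div_le_div_iff₀ hK₁pos hc0]
      have h1 : S / h * ((h : ℝ) - S) ≤ K₁ * (t - k₁) := (div_le_iff₀ htk₁).1 hK₁ge
      calc m₁ * (S / h * ((h : ℝ) - S)) ≤ m₁ * (K₁ * (t - k₁)) := mul_le_mul_of_nonneg_left h1 hm₁0
        _ = m₁ * (t - k₁) * K₁ := by ring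
    have hb2 : l' / Kl ≤ l' * (t - ((k₁ + a : ℕ) : ℝ)) / (S / h * ((h : ℝ) - S)) := by
      rw [div_le_div_iff₀ hKlpos hc0]
      have h1 : S / h * ((h : ℝ) - S) ≤ Kl * (t - ((k₁ + a : ℕ) : ℝ)) := (div_le_iff₀ htl).1 hKlge
      calc l' * (S / h * ((h : ℝ) - S)) ≤ l' * (Kl * (t - ((k₁ + a : ℕ) : ℝ))) := mul_le_mul_of_nonneg_left h1 hl'0
        _ = l' * (t - ((k₁ + a : ℕ) : ℝ)) * Kl := by ring
    have hρle : ρ * (1 - S / h) ≤ (m₁ * (t - k₁) + l' * (t - ((k₁ + a : ℕ) : ℝ))) / S := by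
      have hsum : ρ ≤ (m₁ * (t - k₁) + l' * (t - ((k₁ + a : ℕ) : ℝ))) / (S / h * ((h : ℝ) - S)) := by
        rw [hρ, add_div]; exact add_le_add hb1 hb2
      have hne1 : (h : ℝ) ≠ 0 := hh0.ne'
      have hne2 : (h : ℝ) - S ≠ 0 := by intro h0; linarith
      have hne3 : S ≠ 0 := hS0.ne'
      have e : (m₁ * (t - k₁) + l' * (t - ((k₁ + a : ℕ) : ℝ))) / (S / h * ((h : ℝ) - S)) * (1 - S / h)
          = (m₁ * (t - k₁) + l' * (t - ((k₁ + a : ℕ) : ℝ))) / S := by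
        rw [show (1 : ℝ) - S / h = ((h : ℝ) - S) / h by field_simp]
        field_simp
      calc ρ * (1 - S / h) ≤ (m₁ * (t - k₁) + l' * (t - ((k₁ + a : ℕ) : ℝ))) / (S / h * ((h : ℝ) - S)) * (1 - S / h) :=
            mul_le_mul_of_nonneg_right hsum hw0
        _ = _ := e
    -- the saved income of the absorbed part: α (t − ℓ) ≥ m₂ (k₂ − S)
    have hsave : m₂ * ((k₂ : ℝ) - S) ≤ α * (t - ((k₁ + a : ℕ) : ℝ)) := by
      have hU := usage_mul_sub_le y t S j (k₁ + a) k₂ hy0 hy1 hllow hk₂j hcomp₂ hyk₂ hSt htSl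
      rw [← hUl] at hU
      calc m₂ * ((k₂ : ℝ) - S) = α * (Ul * ((k₂ : ℝ) - S)) := by rw [← hαU]; ring
        _ ≤ α * (t - ((k₁ + a : ℕ) : ℝ)) := mul_le_mul_of_nonneg_left hU hα0
    -- incomes: m₁(t−k₁) + m₁'(t−ℓ) = (1−z)(1−λ)(S − k₁ − agz)
    have hinc : m₁ * (t - k₁) + m₁' * (t - ((k₁ + a : ℕ) : ℝ)) = (1 - z) * (1 - lam) * (S - k₁ - (a : ℝ) * g * z) := by
      simp only [hm₁, hm₁']; push_cast; rw [ht]; ring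
    have hl'inc : m₁ * (t - k₁) + l' * (t - ((k₁ + a : ℕ) : ℝ))
        ≤ (1 - z) * (1 - lam) * (S - k₁ - (a : ℝ) * g * z) - m₂ * ((k₂ : ℝ) - S) := by
      rw [← hinc, hl']
      have : (m₁' - α) * (t - ((k₁ + a : ℕ) : ℝ)) = m₁' * (t - ((k₁ + a : ℕ) : ℝ)) - α * (t - ((k₁ + a : ℕ) : ℝ)) := by ring
      linarith [hsave, this]
    -- top-affordability closes it
    rw [div_mul_eq_mul_div, div_le_iff₀ h1y]
    have hS' : S - (1 - z) * ((k₁ : ℝ) + ((k₂ : ℝ) - k₁) * lam) = 0 := by rw [hmean]; ring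
    have key : y * (z * S + ((1 - z) * (1 - lam) * (S - k₁ - (a : ℝ) * g * z) - m₂ * ((k₂ : ℝ) - S))) ≤ m₂' * (1 - y) * S := by
      -- zS + (1−z)(1−λ)(S−k₁−agz) − m₂(k₂−S) = (1−z)λg(k₂−S) − (1−z)(1−λ)agz   (using hmean)
      have e : z * S + ((1 - z) * (1 - lam) * (S - k₁ - (a : ℝ) * g * z) - m₂ * ((k₂ : ℝ) - S))
          = m₂' * ((k₂ : ℝ) - S) - (1 - z) * (1 - lam) * ((a : ℝ) * g * z)
            + (S - (1 - z) * ((k₁ : ℝ) + ((k₂ : ℝ) - k₁) * lam)) := by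
        simp only [hm₂, hm₂']; ring
      rw [e, hS', add_zero]
      have t1 : 0 ≤ y * ((1 - z) * (1 - lam) * ((a : ℝ) * g * z)) := mul_nonneg hy0.le (mul_nonneg (mul_nonneg h1z.le h1lam) hagz)
      have t2 : y * (m₂' * ((k₂ : ℝ) - S)) ≤ m₂' * (1 - y) * S := by
        have h3 : y * ((k₂ : ℝ) - S) ≤ (1 - y) * S := by linarith
        have h4 := mul_le_mul_of_nonneg_left h3 hm₂'0
        have e5 : y * (m₂' * ((k₂ : ℝ) - S)) = m₂' * (y * ((k₂ : ℝ) - S)) := by ring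
        have e6 : m₂' * (1 - y) * S = m₂' * ((1 - y) * S) := by ring
        rw [e5, e6]; exact h4
      have e4 : y * (m₂' * ((k₂ : ℝ) - S) - (1 - z) * (1 - lam) * ((a : ℝ) * g * z))
          = y * (m₂' * ((k₂ : ℝ) - S)) - y * ((1 - z) * (1 - lam) * ((a : ℝ) * g * z)) := by ring
      rw [e4]; linarith [t1, t2]
    have hS0' : 0 < S := hS0
    calc y * (z + ρ * (1 - S / h)) ≤ y * (z + ((1 - z) * (1 - lam) * (S - k₁ - (a : ℝ) * g * z) - m₂ * ((k₂ : ℝ) - S)) / S) := by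
          refine mul_le_mul_of_nonneg_left ?_ hy0.le
          have := div_le_div_of_nonneg_right hl'inc hS0.le
          linarith
      _ = y * (z * S + ((1 - z) * (1 - lam) * (S - k₁ - (a : ℝ) * g * z) - m₂ * ((k₂ : ℝ) - S))) / S := by
          field_simp
      _ ≤ m₂' * (1 - y) * S / S := div_le_div_of_nonneg_right key hS0.le
      _ = m₂' * (1 - y) := by field_simp
  -- the P-side, part 2: the zeros ride the giant k₂ + a
  have Pg : FlowAtT y t j (M + a) (fun p => (θ * (1 - S / h) + (1 - θ) * z) * (if p = 0 then (1 : ℝ) else 0)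
      + (1 - θ) * m₂' * (if p = k₂ + a then (1 : ℝ) else 0)) := by
    have hz' : 0 ≤ θ * (1 - S / h) + (1 - θ) * z := add_nonneg (mul_nonneg hθ0 hw0) (mul_nonneg h1θ.le hz0)
    refine flowAtT_of_giants y t j (M + a) _ hy0 hy1 (fun p => ?_) ?_
    · refine add_nonneg (mul_nonneg hz' ?_) (mul_nonneg (mul_nonneg h1θ.le hm₂'0) ?_) <;> split_ifs <;> norm_num
    · have hl : ∑ l ∈ Finset.range (j + 1), (if 2 * (l : ℝ) < t then
          (θ * (1 - S / h) + (1 - θ) * z) * (if l = 0 then (1 : ℝ) else 0) + (1 - θ) * m₂' * (if l = k₂ + a then (1 : ℝ) else 0)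
          else 0) = θ * (1 - S / h) + (1 - θ) * z := by
        have e : ∀ l ∈ Finset.range (j + 1), (if 2 * (l : ℝ) < t then
            (θ * (1 - S / h) + (1 - θ) * z) * (if l = 0 then (1 : ℝ) else 0) + (1 - θ) * m₂' * (if l = k₂ + a then (1 : ℝ) else 0)
            else 0) = (θ * (1 - S / h) + (1 - θ) * z) * (if l = 0 then (1 : ℝ) else 0) := by
          intro l hl
          have hl' : l ≤ j := Nat.lt_succ_iff.1 (Finset.mem_range.1 hl)
          rw [if_neg (show l ≠ k₂ + a by omega)]
          by_cases hl0 : l = 0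
          · subst hl0; rw [if_pos (by push_cast; linarith)]; ring
          · rw [if_neg hl0]; split_ifs <;> ring
        rw [Finset.sum_congr rfl e]
        exact sum_mul_indicator (fun _ => θ * (1 - S / h) + (1 - θ) * z) j 0 (by omega)
      have hg' : ∑ p ∈ Finset.Ico (j + 1) (M + a + 1),
          ((θ * (1 - S / h) + (1 - θ) * z) * (if p = 0 then (1 : ℝ) else 0) + (1 - θ) * m₂' * (if p = k₂ + a then (1 : ℝ) else 0))
          = (1 - θ) * m₂' := by
        have e : ∀ p ∈ Finset.Ico (j + 1) (M + a + 1),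
            ((θ * (1 - S / h) + (1 - θ) * z) * (if p = 0 then (1 : ℝ) else 0) + (1 - θ) * m₂' * (if p = k₂ + a then (1 : ℝ) else 0))
              = (1 - θ) * m₂' * (if p = k₂ + a then (1 : ℝ) else 0) := by
          intro p hp
          have : p ≠ 0 := by have := (Finset.mem_Ico.1 hp).1; omega
          rw [if_neg this]; ring
        rw [Finset.sum_congr rfl e, ← Finset.mul_sum, Finset.sum_ite_eq' (Finset.Ico (j + 1) (M + a + 1)) (k₂ + a),
          if_pos (Finset.mem_Ico.2 ⟨hk₂aG, by omega⟩)]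
        ring
      rw [hl, hg']
      have e1 : θ * (1 - S / h) + (1 - θ) * z = (1 - θ) * (z + ρ * (1 - S / h)) := by linear_combination (1 - S / h) * hθρ
      rw [e1, show y / (1 - y) * ((1 - θ) * (z + ρ * (1 - S / h))) = (1 - θ) * (y / (1 - y) * (z + ρ * (1 - S / h))) by ring]
      exact mul_le_mul_of_nonneg_left hineq h1θ.le
  -- assemble
  have hsumflow := FlowAtT.add (FlowAtT.add W1 Wl) (FlowAtT.add Pk₂ Pg)
  have hflow : FlowAtT y t j (M + a) (fun p => θ * weakMidLaw S g h a p
      + (1 - θ) * (z * (if p = 0 then (1 : ℝ) else 0) + (1 - z) * slice (fun q => TP[k₁, k₂, lam, q]) a g p)) := by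
    refine (congrArg (FlowAtT y t j (M + a)) (funext fun p => ?_)).mp hsumflow
    rw [movedTwoPoint_apply, ← hm₁, ← hm₁', ← hm₂, ← hm₂']
    unfold weakMidLaw
    have e1 : (1 - θ) * m₁ = c₁ * K₁ := hc₁K.symm
    have e2 : (1 - θ) * m₁' = cl * Kl + (1 - θ) * α := by rw [hclK, hl']; ring
    have e3 : θ * (S / h * (1 - g)) = c₁ * (S / h * (1 - g)) + cl * (S / h * (1 - g)) := by rw [← add_mul, hcsum]
    have e4 : θ * (S / h * g) = c₁ * (S / h * g) + cl * (S / h * g) := by rw [← add_mul, hcsum]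
    linear_combination (-(if p = k₁ then (1 : ℝ) else 0)) * e1 - (if p = k₁ + a then (1 : ℝ) else 0) * e2
      - (if p = h then (1 : ℝ) else 0) * e3 - (if p = h + a then (1 : ℝ) else 0) * e4
  exact gatedSliceMixLaw_conclusion_of_flowAtT y z g S lam θ a j M h k₁ k₂ hy0 hy1 hhM hk hk₂M hθ0 hθ1 hflow

end LawDec

end Quant

end Summit.CriticalPhenomena.PercolationContinuityZ3.Theorems
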